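import Summits.Ventures.LatticeQCDFlow.Scaling.GraphSchemeSpectralGap
import Summits.Ventures.LatticeQCDFlow.Scaling.FlowGraphConjugacy
import Summits.Ventures.LatticeQCDFlow.Scaling.FlowLadderWilsonFloor

/-!
HONEST FRAMING: exact (Metropolis-corrected) sampling algorithms for lattice gauge theory; figures
of merit are autocorrelation/cost numbers at stated couplings and volumes; no continuum-physics
claim.

# FlowGraphSharpLaw — PERFECT CONSISTENT TRANSPORTS ON ANY SWAP TOPOLOGY: THE MAP-ASSISTED EXCHANGE SCHEME `t·ptGraphSwap μ e φ + (1−t)·prodKernel w M` WITH `φ_r = L_{l_r}⁻¹∘L_{i_r}`,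
# `μ_i∘L_i⁻¹ = μ_0` (every map swap accepted), EXACT HOT SAMPLER, IDLE COLD REPLICAS, HAS THE SAME DISTANCE PROFILE AS THE HOMOGENEOUS SCHEME FOR `μ_0` ON THE SAME LIST; HENCE ON EVERY
# CONNECTED LIST **`γ = ρ_G`** AND **`((1−ρ_G)/ρ_G)·log((1−μ_0(u))Σc/4) ≤ t_mix(1/4) ≤ ⌈(1/ρ_G)·log(4h/ρ_G)⌉`**, `(1/ρ_G − 1)·log(1/(2ε)) ≤ t_mix(ε)` — ARBITRARY COLD LAWS
# (lean-2 GEN-48, ours)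

Venture-side (OURS).  Cell `lqcd-flow` (pub-lqcd), unit `pub-lqcd-lean-2-g48`, 2026-08-31.  Chapter AI (the sizes of the Robin ground state), file 11 — parents AI10 `GraphSchemeSpectralGap` (AI4),
chapter K file 8 `FlowGraphConjugacy` (the change of coordinates `Ψ(x)_k = L_k(x_k)` on any edge list), AG4 `FlowLadderWilsonFloor` (the conjugate hot sampler ∕ idle kernels).  The venture's
object — replica exchange between DIFFERENT laws `μ_k` through learned bijections — reduces, when the maps are consistent along the graph (`φ_r = L_{l_r}⁻¹∘L_{i_r}`, as composed flows
are) and perfect (`μ_i∘L_i⁻¹ = μ_0`), to chapter AI's homogeneous scheme for `ν = μ_0` on the same list: (§1) `d_{P^φ, ⊗μ}(n) = d_{P^1_{μ_0}}(n)` for every `n`, equal mixing times and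
(chapter K) equal spectral gaps; (§2) so every result of the chapter transfers verbatim — on a connected list the gap IS the Robin rate `ρ_G` of the topology (AI10), the sharp two-sided law
(AI4) and the relaxation floor hold, inside AI7's universal window; the topology files (AI5 star ∕ complete, AI6 ladder, AI9 ring) give the units.  No definitions.

* §1 `flowGraph_worstTvDist_eq`, `flowGraph_mixingTime_eq`; §2 `flowGraphPerfect_sharp_two_sided`, `flowGraphPerfect_spectralGap_eq`, `flowGraphPerfect_mixingTime_ge_relax`.

Reading (no numerics implied): perfectly trained, mutually consistent transports make every swap free, on any pattern of pairs; what is left is the topology's Robin rate `ρ_G ≤ h/(K+1)`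
— the refresh budget is never beaten, and the transport term is the graph's (`K³/t` ladder ∕ ring, `K²/t` complete, `K/t` star).  NOT CLAIMED: imperfect or inconsistent maps
(rejections break the one-level closure; chapter M's regeneration is the route), non-idle cold kernels.  Literature grade (cell rule): OWN; nothing cited; no new bib keys.
-/

noncomputable section

open Finset Function
open Literature.Probability.MarkovChains

namespace Summit.Ventures.LatticeQCDFlow.Scaling

variable {S : Type*} [Fintype S] [DecidableEq S] {K m : ℕ} {μ : Fin (K + 1) → S → ℝ} {M : Fin (K + 1) → S → S → ℝ} {w : Fin (K + 1) → ℝ} {t : ℝ}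
  {e : Fin m → Fin (K + 1) × Fin (K + 1)}

section LevelMaps
variable (L : Fin (K + 1) → Equiv.Perm S)

/-! ## §1 The distance profile is that of the conjugate homogeneous scheme -/

/-- **THE MAP-ASSISTED SCHEME'S DISTANCE PROFILE IS THAT OF THE CONJUGATE IDENTITY-MAP SCHEME** (consistent maps `φ_r = L_{l_r}⁻¹∘L_{i_r}`, distinct endpoints):
`d_{P^φ, ⊗μ}(n) = d_{P^1_{ν}, ⊗ν}(n)`, `ν_k = μ_k∘L_k⁻¹`, conjugate updates. [ours] -/
theorem flowGraph_worstTvDist_eq (he : ∀ r, (e r).1 ≠ (e r).2) (t : ℝ) (w : Fin (K + 1) → ℝ) (μ : Fin (K + 1) → S → ℝ) (M : Fin (K + 1) → S → S → ℝ) (n : ℕ) :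
    worstTvDist (fun x y : Fin (K + 1) → S => t * ptGraphSwap μ e (fun r => (L (e r).1).trans (L (e r).2).symm) x y + (1 - t) * prodKernel w M x y) (tensorFun μ) n
      = worstTvDist (fun x y : Fin (K + 1) → S => t * ptGraphSwap (fun i u => μ i ((L i).symm u)) e (fun _ : Fin m => Equiv.refl S) x y
          + (1 - t) * prodKernel w (fun i u v => M i ((L i).symm u) ((L i).symm v)) x y) (tensorFun (fun i u => μ i ((L i).symm u))) n := by
  have hP : (fun x y : Fin (K + 1) → S => t * ptGraphSwap μ e (fun r => (L (e r).1).trans (L (e r).2).symm) x y + (1 - t) * prodKernel w M x y)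
      = fun a b => (fun x y : Fin (K + 1) → S => t * ptGraphSwap (fun i u => μ i ((L i).symm u)) e (fun _ : Fin m => Equiv.refl S) x y
          + (1 - t) * prodKernel w (fun i u v => M i ((L i).symm u) ((L i).symm v)) x y) (Equiv.piCongrRight L a) (Equiv.piCongrRight L b) := by
    funext a b; exact flowGraph_apply_eq_conj L he t w a b
  have hπ : tensorFun μ = fun a => tensorFun (fun i u => μ i ((L i).symm u)) (Equiv.piCongrRight L a) := by
    funext a; exact tensorFun_relabel L μ a
  rw [hP, hπ]
  exact worstTvDist_relabel (Equiv.piCongrRight L)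
    (fun x y : Fin (K + 1) → S => t * ptGraphSwap (fun i u => μ i ((L i).symm u)) e (fun _ : Fin m => Equiv.refl S) x y
      + (1 - t) * prodKernel w (fun i u v => M i ((L i).symm u) ((L i).symm v)) x y) (tensorFun (fun i u => μ i ((L i).symm u))) n

/-- The map-assisted scheme and its conjugate identity-map scheme have the same mixing times. [ours] -/
theorem flowGraph_mixingTime_eq (he : ∀ r, (e r).1 ≠ (e r).2) (t : ℝ) (w : Fin (K + 1) → ℝ) (μ : Fin (K + 1) → S → ℝ) (M : Fin (K + 1) → S → S → ℝ) (ε : ℝ) :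
    mixingTime (fun x y : Fin (K + 1) → S => t * ptGraphSwap μ e (fun r => (L (e r).1).trans (L (e r).2).symm) x y + (1 - t) * prodKernel w M x y) (tensorFun μ) ε
      = mixingTime (fun x y : Fin (K + 1) → S => t * ptGraphSwap (fun i u => μ i ((L i).symm u)) e (fun _ : Fin m => Equiv.refl S) x y
          + (1 - t) * prodKernel w (fun i u v => M i ((L i).symm u) ((L i).symm v)) x y) (tensorFun (fun i u => μ i ((L i).symm u))) ε :=
  mixingTime_congr_of_worstTvDist (flowGraph_worstTvDist_eq L he t w μ M) ε

/-! ## §2 Perfect consistent transports: the chapter transfers -/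

/-- **PERFECT CONSISTENT TRANSPORTS ON A CONNECTED LIST — THE SHARP TWO-SIDED LAW:** `L_0 = 1`, `μ_i∘L_i⁻¹ = μ_0` for every level, `μ_0 > 0` a probability vector, exact hot sampler
`M_0(·,v) = μ_0(v)`, idle cold kernels, `w` a probability vector with `w_0 > 0`, `0 < t < 1`, `m ≥ 1`, distinct endpoints, connected list, `h = (1−t)w_0`; then the ground state `(c, ρ)` of
the list (`c > 0`, `Σc² = 1`, `c_0 = min`, `0 < ρ ≤ h/(K+1)`, the vertex equations) gives, for every content `u`,
**`((1−ρ)/ρ)·log((1−μ_0(u))Σ_kc_k/4) ≤ t_mix(P^φ; 1/4) ≤ ⌈(1/ρ)·log(4h/ρ)⌉`**. [ours] -/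
theorem flowGraphPerfect_sharp_two_sided (hL0 : L 0 = Equiv.refl S) (hm : 1 ≤ m) (he : ∀ r, (e r).1 ≠ (e r).2)
    (hconn : ∀ A : Finset (Fin (K + 1)), A.Nonempty → A ≠ univ → ∃ r : Fin m, ((e r).1 ∈ A ∧ (e r).2 ∉ A) ∨ ((e r).2 ∈ A ∧ (e r).1 ∉ A))
    (hμ0 : ∀ v, 0 < μ 0 v) (hμ01 : ∑ v, μ 0 v = 1) (hM0 : ∀ u v, M 0 u v = μ 0 v) (hidle : ∀ i : Fin K, ∀ u v, M i.succ u v = if v = u then 1 else 0)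
    (hw0 : ∀ k, 0 ≤ w k) (hw00 : 0 < w 0) (hw1 : ∑ k, w k = 1) (ht0 : 0 < t) (ht1 : t < 1)
    (hperf : ∀ (i : Fin (K + 1)) (u : S), μ i ((L i).symm u) = μ 0 u) (u : S) :
    ∃ (ρ : ℝ) (c : Fin (K + 1) → ℝ), 0 < ρ ∧ ρ ≤ (1 - t) * w 0 / ((K : ℝ) + 1) ∧ (∀ k, 0 < c k) ∧ ∑ k : Fin (K + 1), c k ^ 2 = 1 ∧ (∀ k, c 0 ≤ c k) ∧
      (∀ k : Fin (K + 1), t / m * ∑ r : Fin m, ((if k = (e r).1 then c (e r).2 - c (e r).1 else 0) + (if k = (e r).2 then c (e r).1 - c (e r).2 else 0))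
        - (if k = 0 then (1 - t) * w 0 * c k else 0) = -ρ * c k) ∧
      (1 - ρ) / ρ * Real.log ((1 - μ 0 u) * (∑ k : Fin (K + 1), c k) / 4)
          ≤ (mixingTime (fun x y : Fin (K + 1) → S => t * ptGraphSwap μ e (fun r => (L (e r).1).trans (L (e r).2).symm) x y + (1 - t) * prodKernel w M x y)
              (tensorFun μ) (1 / 4) : ℝ) ∧
      mixingTime (fun x y : Fin (K + 1) → S => t * ptGraphSwap μ e (fun r => (L (e r).1).trans (L (e r).2).symm) x y + (1 - t) * prodKernel w M x y)
          (tensorFun μ) (1 / 4) ≤ ⌈1 / ρ * Real.log (4 * ((1 - t) * w 0) / ρ)⌉₊ := by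
  rw [flowGraph_mixingTime_eq L he t w μ M]
  have hν : (fun (i : Fin (K + 1)) (u : S) => μ i ((L i).symm u)) = fun _ : Fin (K + 1) => μ 0 := funext fun i => funext fun u => hperf i u
  rw [hν]
  exact graphScheme_sharp_two_sided_exists e (M := fun i u v => M i ((L i).symm u) ((L i).symm v)) hm he hconn hμ0 hμ01
    (relabelLadder_hotSampler L hL0 hM0) (relabelLadder_idle L hidle) hw0 hw00 hw1 ht0 ht1 (fun _ _ => rfl) u

/-- **PERFECT CONSISTENT TRANSPORTS ON A CONNECTED LIST — THE SPECTRAL GAP IS THE TOPOLOGY'S ROBIN RATE:** under the same hypotheses (`|S| ≥ 2`) there are `ρ`, `c > 0` (`Σc² = 1`, the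
vertex equations, `ρ(K+1) ≤ h`) with **`γ_{⊗μ}(P^φ) = ρ`**. [ours] -/
theorem flowGraphPerfect_spectralGap_eq [Nontrivial S] (hL0 : L 0 = Equiv.refl S) (hm : 1 ≤ m) (he : ∀ r, (e r).1 ≠ (e r).2)
    (hconn : ∀ A : Finset (Fin (K + 1)), A.Nonempty → A ≠ univ → ∃ r : Fin m, ((e r).1 ∈ A ∧ (e r).2 ∉ A) ∨ ((e r).2 ∈ A ∧ (e r).1 ∉ A))
    (hμ0 : ∀ v, 0 < μ 0 v) (hμ01 : ∑ v, μ 0 v = 1) (hM0 : ∀ u v, M 0 u v = μ 0 v) (hidle : ∀ i : Fin K, ∀ u v, M i.succ u v = if v = u then 1 else 0)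
    (hw0 : ∀ k, 0 ≤ w k) (hw00 : 0 < w 0) (hw1 : ∑ k, w k = 1) (ht0 : 0 < t) (ht1 : t < 1)
    (hperf : ∀ (i : Fin (K + 1)) (u : S), μ i ((L i).symm u) = μ 0 u) :
    ∃ (ρ : ℝ) (c : Fin (K + 1) → ℝ), 0 < ρ ∧ ρ * ((K : ℝ) + 1) ≤ (1 - t) * w 0 ∧ (∀ k, 0 < c k) ∧ ∑ k : Fin (K + 1), c k ^ 2 = 1 ∧
      (∀ k : Fin (K + 1), t / m * ∑ r : Fin m, ((if k = (e r).1 then c (e r).2 - c (e r).1 else 0) + (if k = (e r).2 then c (e r).1 - c (e r).2 else 0))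
        - (if k = 0 then (1 - t) * w 0 * c k else 0) = -ρ * c k) ∧
      spectralGap (tensorFun μ) (fun x y : Fin (K + 1) → S => t * ptGraphSwap μ e (fun r => (L (e r).1).trans (L (e r).2).symm) x y + (1 - t) * prodKernel w M x y) = ρ := by
  rw [flowGraph_spectralGap_eq L he t w]
  have hν : (fun (i : Fin (K + 1)) (u : S) => μ i ((L i).symm u)) = fun _ : Fin (K + 1) => μ 0 := funext fun i => funext fun u => hperf i u
  rw [hν]
  exact graphScheme_spectralGap_exists e (M := fun i u v => M i ((L i).symm u) ((L i).symm v)) hm he hconn hμ0 hμ01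
    (relabelLadder_hotSampler L hL0 hM0) (relabelLadder_idle L hidle) hw0 hw00 hw1 ht0 ht1 (fun _ _ => rfl)

/-- **PERFECT CONSISTENT TRANSPORTS — THE RELAXATION FLOOR FOR EVERY `ε`:** under the same hypotheses, for every positive solution `(c, ρ)` of the list's vertex equations and every
`ε > 0`: **`(1/ρ − 1)·log(1/(2ε)) ≤ t_mix(P^φ; ε)`**. [ours] -/
theorem flowGraphPerfect_mixingTime_ge_relax [Nontrivial S] (hL0 : L 0 = Equiv.refl S) (hm : 1 ≤ m) (he : ∀ r, (e r).1 ≠ (e r).2)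
    (hμ0 : ∀ v, 0 < μ 0 v) (hμ01 : ∑ v, μ 0 v = 1) (hM0 : ∀ u v, M 0 u v = μ 0 v) (hidle : ∀ i : Fin K, ∀ u v, M i.succ u v = if v = u then 1 else 0)
    (hw0 : ∀ k, 0 ≤ w k) (hw00 : 0 < w 0) (hw1 : ∑ k, w k = 1) (ht0 : 0 < t) (ht1 : t < 1)
    (hperf : ∀ (i : Fin (K + 1)) (u : S), μ i ((L i).symm u) = μ 0 u)
    {c : Fin (K + 1) → ℝ} {ρ : ℝ} (hρ0 : 0 < ρ) (hc : ∀ k, 0 < c k)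
    (hvertex : ∀ k : Fin (K + 1), t / m * ∑ r : Fin m, ((if k = (e r).1 then c (e r).2 - c (e r).1 else 0) + (if k = (e r).2 then c (e r).1 - c (e r).2 else 0))
      - (if k = 0 then (1 - t) * w 0 * c k else 0) = -ρ * c k) {ε : ℝ} (hε : 0 < ε) :
    (1 / ρ - 1) * Real.log (1 / (2 * ε))
      ≤ (mixingTime (fun x y : Fin (K + 1) → S => t * ptGraphSwap μ e (fun r => (L (e r).1).trans (L (e r).2).symm) x y + (1 - t) * prodKernel w M x y)
          (tensorFun μ) ε : ℝ) := by
  rw [flowGraph_mixingTime_eq L he t w μ M]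
  have hν : (fun (i : Fin (K + 1)) (u : S) => μ i ((L i).symm u)) = fun _ : Fin (K + 1) => μ 0 := funext fun i => funext fun u => hperf i u
  rw [hν]
  exact graphScheme_mixingTime_ge_relax e (M := fun i u v => M i ((L i).symm u) ((L i).symm v)) hm he hμ0 hμ01
    (relabelLadder_hotSampler L hL0 hM0) (relabelLadder_idle L hidle) hw0 hw00 hw1 ht0 ht1 (fun _ _ => rfl) hρ0 hc hvertex hε

end LevelMaps

end Summit.Ventures.LatticeQCDFlow.Scaling

end
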